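import Literature.Analysis.FluidPDE.TorusNSBeiraoDaVeigaCriterion
import Literature.Analysis.FluidPDE.TorusNSFoiasGuillopeTemam
import HarnessLib

/-!
# Gibbon's chessboard of bounded time averages on `T³`: the rows `n = 1`, `1 < m ≤ 3`
# (`∫₀ᵀ ‖∇u‖_{L^{2m}}^{2m/(4m−3)} dt`) and `n = 0`, `3 < m < ∞` (`∫₀ᵀ ‖u‖_{L^{2m}}^{2m/(2m−3)} dt`)
# for classical Navier–Stokes solutions

Analysis/FluidPDE proof file (theorems only; no definitions, no named facts).

Search for candidate a priori estimates; no regularity claim. Sequel of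
`TorusNSFoiasGuillopeTemam.lean` (the Foias–Guillopé–Temam bounds `∫₀ᵀ‖∇u‖₂² ≤ ‖u₀‖₂²/(2ν)`,
`∫₀ᵀ‖Δu‖₂^{2/3} ≤ …`, and the explicit Agmon majorant). Gibbon (J. Nonlinear Sci. 29 (2019),
Theorems 1–2, proofs in Appendix A) rolls the known a priori bounds for weak solutions of the 3D
Navier–Stokes equations into the "chessboard" `⟨‖∇ⁿu‖_{L^{2m}}^{α_{n,m}}⟩_T < ∞`,
`α_{n,m} = 2m/(2m(n+1)−3)`, for `n ≥ 1, 1 ≤ m ≤ ∞` and `n = 0, 3 < m ≤ ∞`. Here the two rows that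
need only the `H¹`–`H²` quantities `‖∇u‖₂², ‖Δu‖₂²` of the tree are PROVED on the unit torus `T^d`,
`card d = 3`, for classical solutions with mean-zero slices on `[0, T]`, written out in
`ν, T, ‖u(0)‖₂` (`E = ‖u(0)‖₂²/(2ν)`, `Y₁ = 1/ν + 27‖u(0)‖₂²/(8π⁴ν⁵)`; one inexplicit factor each,
the tree's Sobolev constants), following the printed proofs line by line:

* Row `n = 1`, `1 < m < 3` (Appendix A §5.1 with `N = 1`, which is exactly the range
  `a = 3(m−1)/(2m) < 1`): (A.2) = `L²`–`L⁶` interpolation + Sobolev,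
  `‖∇v‖_{2m}^{2m} ≤ C₆^{(m−1)/2} ‖∇v‖₂^{3−m} ‖Δv‖₂^{3(m−1)}`
  (`Torus.integral_gradSq_rpow_le_of_cube_le`); then (A.3)–(A.4): raise to `1/(4m−3)`, Hölder in
  time with exponents `2(4m−3)/(9(m−1))`, `2(4m−3)/(3−m)` against
  `∫₀ᵀ‖Δu‖₂^{2/3} ≤ Y₁^{1/3}(T+E)^{2/3}`, `∫₀ᵀ‖∇u‖₂² ≤ E`:
  `∫₀ᵀ (∫|∇u|^{2m})^{1/(4m−3)} dt ≤ C₆^{(m−1)/(2(4m−3))} Y₁^{3(m−1)/(2(4m−3))}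
    (T+E)^{3(m−1)/(4m−3)} E^{(3−m)/(2(4m−3))}`, `|∇u|² = ∑ⱼ‖∂ⱼu‖²`
  (`Torus.exists_classicalNS_integral_gradSq_rpow_le`), its vorticity form (Gibbon's `D_m`;
  `|ω|² ≤ 2|∇u|²`) (`Torus.exists_classicalNS_integral_vorticitySq_rpow_le`), and the endpoint
  square `(1, 3)` (`a = 1`: plain Sobolev), `∫₀ᵀ (∫|∇u|⁶)^{1/9} ≤ C₆^{1/9} Y₁^{1/3}(T+E)^{2/3}`
  (`Torus.exists_classicalNS_integral_gradL6_twoThirds_le`).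
* Row `n = 0`, `3 < m < ∞` (Appendix A §5.2 with `N = 2`): the mean-zero Sobolev bound
  `∫‖v‖⁶ ≤ C(∫|∇v|²)³` (`Torus.exists_integral_norm_pow_six_le_gradNormSq_cube`) and sup × `L⁶`
  with the explicit Agmon majorant give (A.8) in the form
  `∫‖v‖^{2m} ≤ C(4/π⁴)^{(m−3)/2} ‖∇v‖₂^{m+3} ‖Δv‖₂^{m−3}` (`Torus.integral_norm_rpow_le_of_six_le`);
  then (A.9)–(A.10): Hölder in time with exponents `2(2m−3)/(3(m−3))`, `2(2m−3)/(m+3)`: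
  `∫₀ᵀ (∫‖u‖^{2m})^{1/(2m−3)} dt ≤ K Y₁^{(m−3)/(2(2m−3))} (T+E)^{(m−3)/(2m−3)} E^{(m+3)/(2(2m−3))}`
  (`Torus.exists_classicalNS_integral_norm_rpow_le`).

Scope (faithfulness): Gibbon states Theorems 1–2 for Leray–Hopf weak solutions of the forced
equations on a periodic box in terms of the Reynolds number of the forcing, `≤ c_{n,m} Re³ + O(T⁻¹)`;
here: unforced, classical solutions on `[0, T] × T³` with mean-zero slices, the bounds written out
in `ν, T, ‖u(0)‖₂`; only the squares `(1, m)`, `1 < m ≤ 3`, and `(0, m)`, `3 < m < ∞` (the corner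
`(1, 1)` is the energy inequality `Torus.classicalNS_integral_gradNormSq_le`, `(0, ∞)` is the
bounded total speed `Torus.classicalNS_integral_agmonMajorant_le`, `(2, 1)` is
`Torus.classicalNS_integral_laplacian_twoThirds_le`; `(1, m)` with `3 < m ≤ ∞` and all rows
`n ≥ 2` need the `H³` balance, not in the tree; `(0, m)`, `m ≤ 3`, is excluded in print).

## Mathlib / tree search

Tree (used): `Torus.integral_rpow_le_interpolate_two_six'` (`TorusNSBeiraoDaVeigaCriterion`),
`Torus.exists_integral_gradSq_cube_le_laplacianSq_cube` (`TorusNSSerrinCriterion`),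
`Torus.lintegral_enorm_pow_six_le_cube_of_isSmooth` (`TorusSobolevL6`),
`Torus.integral_norm_sq_le_of_hasZeroMean`, `Torus.integral_norm_fderiv_sq_le_card_mul_gradNormSq`
(`TorusTrilinearH1`), `Torus.classicalNS_integral_laplacian_twoThirds_le`,
`Torus.classicalNS_integral_gradNormSq_le`, `Torus.norm_le_agmonMajorant`
(`TorusNSFoiasGuillopeTemam`), `Torus.eventually_norm_sub_lt_of_continuousOn` (tube lemma,
`TorusSpaceTime`), `torusVorticitySqAt_le_two_mul_sum_norm_sq`; Mathlib
`integral_mul_le_Lp_mul_Lq_of_nonneg`. Searched: `chessboard|Gibbon|timeAverage|rpow_le.*laplacian`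
— nothing on time averages of `L^{2m}` norms along Navier–Stokes solutions.

## References

* [Gibbon2019Chessboard] J. D. Gibbon, *Weak and strong solutions of the 3D Navier–Stokes
  equations and their relation to a chessboard of convergent inverse length scales*,
  J. Nonlinear Sci. 29 (2019) 215–228, Theorems 1–2, Appendix A §§5.1–5.2 (held: arXiv:1803.11518,
  pp. 4–7).
* [FoiasGuillopeTemam1981] C. Foias, C. Guillopé, R. Temam, *New a priori estimates for
  Navier–Stokes equations in dimension 3*, Comm. PDE 6 (1981) 329–359, Thm 3.1.
* [RobinsonRodrigoSadowskiCUP2016] Lemma 8.15 (the `H¹`–`H²` route to the FGT bounds), Thm 1.18.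
-/

noncomputable section

open Set MeasureTheory intervalIntegral Filter Real
open scoped InnerProductSpace RealInnerProductSpace Topology ENNReal

namespace Literature.Analysis.FluidPDE

open Literature.Analysis.FunctionSpaces

variable {d : Type*} [Fintype d] [DecidableEq d]

/-! ### Continuity in time of space integrals (tube lemma) -/

omit [DecidableEq d] in
/-- A field on `S × T^d` whose space–time lift is continuous on `S × ℝ^d` and whose slices are
continuous has `t ↦ ∫ φ t x dx` continuous on `S` (uniform-in-space continuity in time over the
compact torus, `Torus.eventually_norm_sub_lt_of_continuousOn`). [folklore] -/
private theorem continuousOn_integral_of_continuousOn_stLift {S : Set ℝ}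
    {φ : ℝ → UnitAddTorus d → ℝ} (hφ : ContinuousOn (Torus.stLift φ) (S ×ˢ univ))
    (hsl : ∀ t ∈ S, Continuous (φ t)) : ContinuousOn (fun t => ∫ x, φ t x) S := by
  intro t ht
  rw [ContinuousWithinAt, Metric.tendsto_nhds]
  intro ε hε
  have h := Torus.eventually_norm_sub_lt_of_continuousOn hφ ht (half_pos hε)
  filter_upwards [h, self_mem_nhdsWithin] with s hs hsS
  have his : Integrable (φ s) := (hsl s hsS).integrable_unitAddTorus
  have hit : Integrable (φ t) := (hsl t ht).integrable_unitAddTorus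
  rw [Real.dist_eq, ← integral_sub his hit]
  calc |∫ x, (φ s x - φ t x)| ≤ ∫ x, |φ s x - φ t x| := abs_integral_le_integral_abs
    _ ≤ ∫ _x : UnitAddTorus d, ε / 2 := by
        refine integral_mono_of_nonneg (ae_of_all _ fun x => abs_nonneg _) (integrable_const _)
          (ae_of_all _ fun x => ?_)
        have h1 := hs x
        rw [Real.norm_eq_abs] at h1
        exact h1.le
    _ = ε / 2 := by simp
    _ < ε := half_lt_self hε

/-- Along a classical solution on `[a, b]`, `t ↦ ∫ (∑ⱼ‖∂ⱼu(t)‖²)^m` is continuous on `[a, b]`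
for `0 ≤ m` (joint smoothness of `∂ⱼu`, tube lemma). [folklore] -/
private theorem continuousOn_integral_gradSq_rpow {ν a b : ℝ} (hab : a < b)
    {f u : ℝ → UnitAddTorus d → EuclideanSpace ℝ d} {p : ℝ → UnitAddTorus d → ℝ}
    (h : Torus.IsClassicalNSSolutionOn (Icc a b) ν f u p) {m : ℝ} (hm : 0 ≤ m) :
    ContinuousOn (fun t => ∫ x, (∑ j, ‖Torus.partialDeriv j (u t) x‖ ^ 2) ^ m) (Icc a b) := by
  have hU : UniqueDiffOn ℝ (Icc a b) := uniqueDiffOn_Icc hab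
  have hst : ∀ j, ContinuousOn (Torus.stLift fun t => Torus.partialDeriv j (u t)) (Icc a b ×ˢ univ) :=
    fun j => (h.smooth_velocity.partialDeriv hU j).continuousOn_stLift
  refine continuousOn_integral_of_continuousOn_stLift ?_ fun t ht => ?_
  · have e : Torus.stLift (fun t x => (∑ j, ‖Torus.partialDeriv j (u t) x‖ ^ 2) ^ m) =
        fun q => (∑ j, ‖Torus.stLift (fun t => Torus.partialDeriv j (u t)) q‖ ^ 2) ^ m := rfl
    rw [e]
    exact (continuousOn_finsetSum _ fun j _ => ((hst j).norm).pow 2).rpow_const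
      fun q _ => Or.inr hm
  · have hut : Torus.IsSmooth (u t) := h.smooth_velocity.isSmooth_slice ht
    exact (continuous_finsetSum _ fun j _ =>
      (((hut.partialDeriv j).continuous).norm).pow 2).rpow_const fun x => Or.inr hm

/-- Along a classical solution on `[a, b]`, `t ↦ ∫ |ω(t)|^{2m} = ∫ (torusVorticitySqAt (u t))^m`
is continuous on `[a, b]` for `0 ≤ m`. [folklore] -/
private theorem continuousOn_integral_vorticitySq_rpow {ν a b : ℝ} (hab : a < b)
    {f u : ℝ → UnitAddTorus d → EuclideanSpace ℝ d} {p : ℝ → UnitAddTorus d → ℝ}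
    (h : Torus.IsClassicalNSSolutionOn (Icc a b) ν f u p) {m : ℝ} (hm : 0 ≤ m) :
    ContinuousOn (fun t => ∫ x, torusVorticitySqAt (u t) x ^ m) (Icc a b) := by
  have hU : UniqueDiffOn ℝ (Icc a b) := uniqueDiffOn_Icc hab
  have hst : ∀ j, ContinuousOn (Torus.stLift fun t => Torus.partialDeriv j (u t)) (Icc a b ×ˢ univ) :=
    fun j => (h.smooth_velocity.partialDeriv hU j).continuousOn_stLift
  have hstc : ∀ i j, ContinuousOn (fun q => Torus.stLift (fun t => Torus.partialDeriv i (u t)) q j)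
      (Icc a b ×ˢ univ) :=
    fun i j => (EuclideanSpace.proj j).continuous.comp_continuousOn (hst i)
  refine continuousOn_integral_of_continuousOn_stLift ?_ fun t ht => ?_
  · have e : Torus.stLift (fun t x => torusVorticitySqAt (u t) x ^ m) =
        fun q => (2⁻¹ * ∑ i, ∑ j, (Torus.stLift (fun t => Torus.partialDeriv i (u t)) q j -
          Torus.stLift (fun t => Torus.partialDeriv j (u t)) q i) ^ 2) ^ m := rfl
    rw [e]
    refine ContinuousOn.rpow_const ?_ fun q _ => Or.inr hm
    exact continuousOn_const.mul (continuousOn_finsetSum _ fun i _ =>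
      continuousOn_finsetSum _ fun j _ => ((hstc i j).sub (hstc j i)).pow 2)
  · have hut : Torus.IsSmooth (u t) := h.smooth_velocity.isSmooth_slice ht
    have hc : ∀ i j, Continuous fun x => Torus.partialDeriv i (u t) x j :=
      fun i j => (EuclideanSpace.proj j).continuous.comp (hut.partialDeriv i).continuous
    refine Continuous.rpow_const ?_ fun x => Or.inr hm
    exact continuous_const.mul (continuous_finsetSum _ fun i _ =>
      continuous_finsetSum _ fun j _ => ((hc i j).sub (hc j i)).pow 2)

/-- Continuity of `t ↦ ‖∇u(t)‖₂²` and of `t ↦ ‖Δu(t)‖₂²` on a closed interval along a classical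
solution (`H¹` and `H²` balances). [folklore] -/
private theorem continuousOn_gradNormSq_laplacianSq' {ν a b : ℝ} (hab : a < b)
    {f u : ℝ → UnitAddTorus d → EuclideanSpace ℝ d} {p : ℝ → UnitAddTorus d → ℝ}
    (h : Torus.IsClassicalNSSolutionOn (Icc a b) ν f u p) :
    ContinuousOn (fun t => Torus.gradNormSq (u t)) (Icc a b) ∧
      ContinuousOn (fun t => ∫ x, ‖Torus.laplacian (u t) x‖ ^ 2) (Icc a b) := by
  constructor
  · intro t ht
    have h1 : ContinuousWithinAt (fun s => (2 : ℝ) * (2⁻¹ * Torus.gradNormSq (u s))) (Icc a b) t :=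
      continuousWithinAt_const.mul (h.hasDerivWithinAt_half_gradNormSq hab ht).continuousWithinAt
    refine h1.congr (fun s _ => ?_) ?_ <;> ring
  · intro t ht
    have h1 : ContinuousWithinAt
        (fun s => (2 : ℝ) * (2⁻¹ * ∫ x, ‖Torus.laplacian (u s) x‖ ^ 2)) (Icc a b) t :=
      continuousWithinAt_const.mul
        (h.hasDerivWithinAt_half_integral_norm_laplacian_sq hab ht).continuousWithinAt
    refine h1.congr (fun s _ => ?_) ?_ <;> ring

/-! ### Step (A.2), `n = N = 1`: the Gagliardo–Nirenberg bound for `‖∇v‖_{2m}` -/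

/-- **Gibbon (A.2) with `n = N = 1`, `1 < m < 3`** (`‖∇v‖_{L^{2m}} ≤ C ‖∇²v‖₂^a ‖∇v‖₂^{1−a}`,
`a = 3(m−1)/(2m)`), raised to the power `2m`, on `T^d`: for a smooth `v` with the Sobolev bound
`∫|∇v|⁶ ≤ C (∫‖Δv‖²)³`, `∫ |∇v|^{2m} ≤ C^{(m−1)/2} (∫|∇v|²)^{(3−m)/2} (∫‖Δv‖²)^{3(m−1)/2}`,
`|∇v|² = ∑ⱼ‖∂ⱼv‖²` (`L²`–`L⁶` interpolation `Torus.integral_rpow_le_interpolate_two_six'` with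
`q = 2m`). [cite: Gibbon2019Chessboard, Appendix A §5.1 eq. (A.2) (n = N = 1)] -/
theorem Torus.integral_gradSq_rpow_le_of_cube_le {m : ℝ} (hm1 : 1 < m) (hm3 : m < 3)
    {v : UnitAddTorus d → EuclideanSpace ℝ d} (hv : Torus.IsSmooth v) {C : ℝ} (hC0 : 0 ≤ C)
    (hC : ∫ x, (∑ j, ‖Torus.partialDeriv j v x‖ ^ 2) ^ 3 ≤
      C * (∫ x, ‖Torus.laplacian v x‖ ^ 2) ^ 3) :
    ∫ x, (∑ j, ‖Torus.partialDeriv j v x‖ ^ 2) ^ m ≤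
      C ^ ((m - 1) / 2) * Torus.gradNormSq v ^ ((3 - m) / 2) *
        (∫ x, ‖Torus.laplacian v x‖ ^ 2) ^ (3 * (m - 1) / 2) := by
  set f : UnitAddTorus d → ℝ := fun x => Real.sqrt (∑ j, ‖Torus.partialDeriv j v x‖ ^ 2) with hf
  set G : ℝ := Torus.gradNormSq v with hGdef
  set P : ℝ := ∫ x, ‖Torus.laplacian v x‖ ^ 2 with hPdef
  have hG0 : 0 ≤ G := Torus.gradNormSq_nonneg _
  have hP0 : 0 ≤ P := integral_nonneg fun x => sq_nonneg _
  have hDc : ∀ i, Continuous fun x => Torus.partialDeriv i v x :=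
    fun i => (hv.partialDeriv i).continuous
  have hfc : Continuous f :=
    Real.continuous_sqrt.comp (continuous_finsetSum _ fun i _ => ((hDc i).norm).pow 2)
  have hf0 : ∀ x, 0 ≤ f x := fun x => Real.sqrt_nonneg _
  have hf2 : ∀ x, f x ^ 2 = ∑ j, ‖Torus.partialDeriv j v x‖ ^ 2 := fun x =>
    Real.sq_sqrt (Finset.sum_nonneg fun j _ => sq_nonneg _)
  have hG : ∫ x, f x ^ 2 = G := by simp only [hf2, hGdef, Torus.gradNormSq]
  have hf6 : ∫ x, f x ^ 6 ≤ C * P ^ 3 := by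
    have e : ∀ x, f x ^ 6 = (∑ j, ‖Torus.partialDeriv j v x‖ ^ 2) ^ 3 := fun x => by
      rw [← hf2]; ring
    simp only [e]
    exact hC
  have hI6 : 0 ≤ ∫ x, f x ^ 6 := integral_nonneg fun x => pow_nonneg (hf0 x) 6
  -- `∫ |∇v|^{2m} = ∫ f^{2m}`
  have hfm : ∀ x, f x ^ (2 * m) = (∑ j, ‖Torus.partialDeriv j v x‖ ^ 2) ^ m := fun x => by
    rw [Real.rpow_mul (hf0 x), Real.rpow_two, hf2]
  have hq2 : 2 < 2 * m := by linarith
  have hq6 : 2 * m < 6 := by linarith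
  have hI := Torus.integral_rpow_le_interpolate_two_six' hq2 hq6 hfc hf0
  simp only [hfm] at hI
  rw [hG] at hI
  have x1 : (6 - 2 * m) / 4 = (3 - m) / 2 := by ring
  have x2 : (2 * m - 2) / 4 = (m - 1) / 2 := by ring
  rw [x1, x2] at hI
  refine hI.trans ?_
  have h1 : (∫ x, f x ^ 6) ^ ((m - 1) / 2) ≤ (C * P ^ 3) ^ ((m - 1) / 2) :=
    Real.rpow_le_rpow hI6 hf6 (by linarith)
  have h2 : (C * P ^ 3) ^ ((m - 1) / 2) = C ^ ((m - 1) / 2) * P ^ (3 * (m - 1) / 2) := by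
    rw [Real.mul_rpow hC0 (by positivity), show (P ^ 3 : ℝ) = P ^ (3 : ℝ) by norm_cast,
      ← Real.rpow_mul hP0]
    congr 1
    congr 1
    ring
  calc G ^ ((3 - m) / 2) * (∫ x, f x ^ 6) ^ ((m - 1) / 2)
      ≤ G ^ ((3 - m) / 2) * (C * P ^ 3) ^ ((m - 1) / 2) :=
        mul_le_mul_of_nonneg_left h1 (Real.rpow_nonneg hG0 _)
    _ = C ^ ((m - 1) / 2) * G ^ ((3 - m) / 2) * P ^ (3 * (m - 1) / 2) := by rw [h2]; ring

/-! ### Theorem 2 (i), square `n = 1`, `1 < m < 3` -/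

/-- **Gibbon's chessboard, row `n = 1`, `1 < m < 3`, on `T³`** (classical solutions, written out
in `ν, T, ‖u(0)‖₂`). On `T^d`, `card d = 3`, for `1 < m < 3` there is `K ≥ 0` (namely
`K = C₆^{(m−1)/(2(4m−3))}`, `C₆` the Sobolev constant of
`Torus.exists_integral_gradSq_cube_le_laplacianSq_cube`) such that every classical solution of the
unforced Navier–Stokes equations with `ν > 0` on `[0, T] × T^d`, `T > 0`, with mean-zero velocity
slices satisfies, with `E = ‖u(0)‖₂²/(2ν)`, `Y₁ = 1/ν + 27‖u(0)‖₂²/(8π⁴ν⁵)`,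
`∫₀ᵀ (∫ |∇u(t)|^{2m})^{1/(4m−3)} dt ≤ K · Y₁^{3(m−1)/(2(4m−3))} · (T + E)^{3(m−1)/(4m−3)} ·
E^{(3−m)/(2(4m−3))}`, `|∇u|² = ∑ⱼ‖∂ⱼu‖²` — i.e. `⟨‖∇u‖_{2m}^{α_{1,m}}⟩_T`, `α_{1,m} = 2m/(4m−3)`,
is bounded a priori (printed, for Leray–Hopf weak solutions of the forced equations:
`⟨‖∇ⁿu‖_{2m}^{α_{n,m}}⟩_T ≤ c L⁻¹ν^{α_{n,m}} Re³ + O(T⁻¹)`, `n ≥ 1`, `1 ≤ m ≤ ∞`). Proof as printed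
(Appendix A §5.1 with `N = 1`): (A.2), then Hölder in time with exponents `2(4m−3)/(9(m−1))`,
`2(4m−3)/(3−m)` against the Foias–Guillopé–Temam bounds `∫₀ᵀ‖Δu‖₂^{2/3} ≤ Y₁^{1/3}(T+E)^{2/3}`
and `∫₀ᵀ‖∇u‖₂² ≤ E`.
[cite: Gibbon2019Chessboard, Theorem 2 (i) (n = 1, 1 < m < 3), Appendix A §5.1]
[cite: FoiasGuillopeTemam1981, Thm 3.1] -/
theorem Torus.exists_classicalNS_integral_gradSq_rpow_le (hd : Fintype.card d = 3) {m : ℝ}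
    (hm1 : 1 < m) (hm3 : m < 3) :
    ∃ K : ℝ, 0 ≤ K ∧ ∀ {ν T : ℝ}, 0 < ν → 0 < T →
      ∀ {u : ℝ → UnitAddTorus d → EuclideanSpace ℝ d} {p : ℝ → UnitAddTorus d → ℝ},
        Torus.IsClassicalNSSolutionOn (Icc 0 T) ν 0 u p →
        (∀ t ∈ Icc 0 T, Torus.HasZeroMean (u t)) →
        ∫ t in (0 : ℝ)..T,
            (∫ x, (∑ j, ‖Torus.partialDeriv j (u t) x‖ ^ 2) ^ m) ^ (1 / (4 * m - 3)) ≤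
          K * (1 / ν + 27 * (∫ x, ‖u 0 x‖ ^ 2) / (8 * π ^ 4 * ν ^ 5)) ^
              (3 * (m - 1) / (2 * (4 * m - 3))) *
            (T + (∫ x, ‖u 0 x‖ ^ 2) / (2 * ν)) ^ (3 * (m - 1) / (4 * m - 3)) *
            ((∫ x, ‖u 0 x‖ ^ 2) / (2 * ν)) ^ ((3 - m) / (2 * (4 * m - 3))) := by
  obtain ⟨C₆, hC₆0, hC₆⟩ := Torus.exists_integral_gradSq_cube_le_laplacianSq_cube (d := d) hd
  have h4m : 0 < 4 * m - 3 := by linarith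
  have hm1' : 0 < m - 1 := by linarith
  have h3m : 0 < 3 - m := by linarith
  have h4m' : 4 * m - 3 ≠ 0 := h4m.ne'
  have hm1'' : m - 1 ≠ 0 := hm1'.ne'
  have h3m' : 3 - m ≠ 0 := h3m.ne'
  -- exponents
  set e : ℝ := 1 / (4 * m - 3) with he
  set b : ℝ := 3 * (m - 1) / (2 * (4 * m - 3)) with hb
  set b₂ : ℝ := 3 * (m - 1) / (4 * m - 3) with hb₂
  set a : ℝ := (3 - m) / (2 * (4 * m - 3)) with ha
  have he0 : 0 < e := by rw [he]; positivity
  have hb0 : 0 < b := by rw [hb]; positivity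
  have ha0 : 0 < a := by rw [ha]; positivity
  set K : ℝ := C₆ ^ ((m - 1) / 2 * e) with hK
  have hK0 : 0 ≤ K := Real.rpow_nonneg hC₆0 _
  refine ⟨K, hK0, ?_⟩
  intro ν T hν hT u p h hmean
  have hu0 : 0 ≤ ∫ x, ‖u 0 x‖ ^ 2 := integral_nonneg fun x => sq_nonneg _
  set E : ℝ := (∫ x, ‖u 0 x‖ ^ 2) / (2 * ν) with hE
  set Y : ℝ := 1 / ν + 27 * (∫ x, ‖u 0 x‖ ^ 2) / (8 * π ^ 4 * ν ^ 5) with hY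
  have hE0 : 0 ≤ E := by positivity
  have hY0 : 0 ≤ Y := by positivity
  have hTE : 0 ≤ T + E := by positivity
  set G : ℝ → ℝ := fun s => Torus.gradNormSq (u s) with hGdef
  set P : ℝ → ℝ := fun s => ∫ x, ‖Torus.laplacian (u s) x‖ ^ 2 with hPdef
  have hG0 : ∀ s, 0 ≤ G s := fun s => Torus.gradNormSq_nonneg _
  have hP0 : ∀ s, 0 ≤ P s := fun s => integral_nonneg fun x => sq_nonneg _
  -- Hölder factors `φ = ‖Δu‖₂^{2b}`, `ψ = ‖∇u‖₂^{2a}`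
  set φ : ℝ → ℝ := fun s => P s ^ b with hφ
  set ψ : ℝ → ℝ := fun s => G s ^ a with hψ
  have hφ0 : ∀ s, 0 ≤ φ s := fun s => Real.rpow_nonneg (hP0 s) _
  have hψ0 : ∀ s, 0 ≤ ψ s := fun s => Real.rpow_nonneg (hG0 s) _
  -- the integrand and its pointwise bound (A.2): `(∫|∇u|^{2m})^e ≤ K φ ψ` on `[0, T]`
  set L : ℝ → ℝ := fun s =>
    (∫ x, (∑ j, ‖Torus.partialDeriv j (u s) x‖ ^ 2) ^ m) ^ e with hL
  have hF0 : ∀ s, 0 ≤ ∫ x, (∑ j, ‖Torus.partialDeriv j (u s) x‖ ^ 2) ^ m := fun s =>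
    integral_nonneg fun x => Real.rpow_nonneg (Finset.sum_nonneg fun j _ => sq_nonneg _) _
  have hpt : ∀ s ∈ Icc 0 T, L s ≤ K * (φ s * ψ s) := by
    intro s hs
    have hus : Torus.IsSmooth (u s) := h.smooth_velocity.isSmooth_slice hs
    have h1 : ∫ x, (∑ j, ‖Torus.partialDeriv j (u s) x‖ ^ 2) ^ m ≤
        C₆ ^ ((m - 1) / 2) * G s ^ ((3 - m) / 2) * P s ^ (3 * (m - 1) / 2) :=
      Torus.integral_gradSq_rpow_le_of_cube_le hm1 hm3 hus hC₆0 (hC₆ (u s) hus)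
    have h2 := Real.rpow_le_rpow (hF0 s) h1 he0.le
    refine h2.trans (le_of_eq ?_)
    rw [Real.mul_rpow (mul_nonneg (Real.rpow_nonneg hC₆0 _) (Real.rpow_nonneg (hG0 s) _))
        (Real.rpow_nonneg (hP0 s) _),
      Real.mul_rpow (Real.rpow_nonneg hC₆0 _) (Real.rpow_nonneg (hG0 s) _),
      ← Real.rpow_mul hC₆0, ← Real.rpow_mul (hG0 s), ← Real.rpow_mul (hP0 s)]
    have xa : (3 - m) / 2 * e = a := by rw [ha, he]; field_simp
    have xb : 3 * (m - 1) / 2 * e = b := by rw [hb, he]; field_simp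
    rw [xa, xb, ← hK]
    simp only [hφ, hψ]
    ring
  -- continuity on `[0, T]`
  obtain ⟨hGc, hPc⟩ := continuousOn_gradNormSq_laplacianSq' hT h
  have hφc : ContinuousOn φ (Icc 0 T) := hPc.rpow_const fun s _ => Or.inr hb0.le
  have hψc : ContinuousOn ψ (Icc 0 T) := hGc.rpow_const fun s _ => Or.inr ha0.le
  have hLc : ContinuousOn L (Icc 0 T) :=
    (continuousOn_integral_gradSq_rpow hT h (by linarith : (0 : ℝ) ≤ m)).rpow_const
      fun s _ => Or.inr he0.le
  -- Hölder in time, exponents `p₁ = 2(4m−3)/(9(m−1))`, `q₁ = 2(4m−3)/(3−m)` (A.3)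
  set p₁ : ℝ := 2 * (4 * m - 3) / (9 * (m - 1)) with hp₁
  set q₁ : ℝ := 2 * (4 * m - 3) / (3 - m) with hq₁
  have hpq : p₁.HolderConjugate q₁ := by
    refine Real.holderConjugate_iff.2 ⟨?_, ?_⟩
    · rw [hp₁, lt_div_iff₀ (by positivity)]; linarith
    · rw [hp₁, hq₁]; field_simp; ring
  set μ : Measure ℝ := volume.restrict (Ioc 0 T) with hμ
  haveI : IsFiniteMeasure μ := by rw [hμ]; infer_instance
  have hmemLp : ∀ {g : ℝ → ℝ}, ContinuousOn g (Icc 0 T) → ∀ r : ℝ≥0∞, MemLp g r μ := by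
    intro g hg r
    obtain ⟨C, hC⟩ := isCompact_Icc.exists_bound_of_continuousOn hg
    have hmeas : AEStronglyMeasurable g μ :=
      (hg.mono Ioc_subset_Icc_self).aestronglyMeasurable measurableSet_Ioc
    refine MemLp.of_bound hmeas C ?_
    rw [hμ, ae_restrict_iff' measurableSet_Ioc]
    exact ae_of_all _ fun s hs => hC s (Ioc_subset_Icc_self hs)
  have hH := integral_mul_le_Lp_mul_Lq_of_nonneg (μ := μ) hpq
    (ae_of_all _ fun s => hφ0 s) (ae_of_all _ fun s => hψ0 s) (hmemLp hφc _) (hmemLp hψc _)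
  -- `φ^{p₁} = ‖Δu‖₂^{2/3}`, `ψ^{q₁} = ‖∇u‖₂²` (the exponent condition (A.4))
  have hφp : ∀ s, φ s ^ p₁ = P s ^ ((1 : ℝ) / 3) := fun s => by
    rw [hφ]
    simp only
    rw [← Real.rpow_mul (hP0 s)]
    congr 1
    rw [hb, hp₁, div_mul_div_comm, div_eq_div_iff (by positivity) (by norm_num)]
    ring
  have hψq : ∀ s, ψ s ^ q₁ = G s := fun s => by
    rw [hψ]
    simp only
    rw [← Real.rpow_mul (hG0 s)]
    have : a * q₁ = 1 := by
      rw [ha, hq₁, div_mul_div_comm, div_eq_one_iff_eq (by positivity)]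
      ring
    rw [this, Real.rpow_one]
  have hI2 : ∫ s, φ s ^ p₁ ∂μ = ∫ t in (0 : ℝ)..T, P t ^ ((1 : ℝ) / 3) := by
    rw [intervalIntegral.integral_of_le hT.le, hμ]
    exact integral_congr_ae (ae_of_all _ fun s => hφp s)
  have hI3 : ∫ s, ψ s ^ q₁ ∂μ = ∫ t in (0 : ℝ)..T, G t := by
    rw [intervalIntegral.integral_of_le hT.le, hμ]
    exact integral_congr_ae (ae_of_all _ fun s => hψq s)
  rw [hI2, hI3] at hH
  -- the Foias–Guillopé–Temam inputs
  have hA : ∫ t in (0 : ℝ)..T, P t ^ ((1 : ℝ) / 3) ≤ Y ^ ((1 : ℝ) / 3) * (T + E) ^ ((2 : ℝ) / 3) :=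
    Torus.classicalNS_integral_laplacian_twoThirds_le hd hν hT h hmean
  have hB : ∫ t in (0 : ℝ)..T, G t ≤ E := Torus.classicalNS_integral_gradNormSq_le hν hT h
  have hA0 : 0 ≤ ∫ t in (0 : ℝ)..T, P t ^ ((1 : ℝ) / 3) :=
    intervalIntegral.integral_nonneg hT.le fun s _ => Real.rpow_nonneg (hP0 s) _
  have hB0 : 0 ≤ ∫ t in (0 : ℝ)..T, G t := intervalIntegral.integral_nonneg hT.le fun s _ => hG0 s
  have x1p : 1 / p₁ = 9 * (m - 1) / (2 * (4 * m - 3)) := by rw [hp₁, one_div_div]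
  have x1q : 1 / q₁ = a := by rw [hq₁, ha, one_div_div]
  have hH' : ∫ s, φ s * ψ s ∂μ ≤ Y ^ b * (T + E) ^ b₂ * E ^ a := by
    refine hH.trans ?_
    rw [x1p, x1q]
    have h1 : (∫ t in (0 : ℝ)..T, P t ^ ((1 : ℝ) / 3)) ^ (9 * (m - 1) / (2 * (4 * m - 3))) ≤
        Y ^ b * (T + E) ^ b₂ := by
      have h := Real.rpow_le_rpow hA0 hA
        (by positivity : (0 : ℝ) ≤ 9 * (m - 1) / (2 * (4 * m - 3)))
      refine h.trans (le_of_eq ?_)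
      rw [Real.mul_rpow (Real.rpow_nonneg hY0 _) (Real.rpow_nonneg hTE _), ← Real.rpow_mul hY0,
        ← Real.rpow_mul hTE]
      have y1 : (1 : ℝ) / 3 * (9 * (m - 1) / (2 * (4 * m - 3))) = b := by
        rw [hb]; field_simp; ring
      have y2 : (2 : ℝ) / 3 * (9 * (m - 1) / (2 * (4 * m - 3))) = b₂ := by
        rw [hb₂]; field_simp; ring
      rw [y1, y2]
    have h2 : (∫ t in (0 : ℝ)..T, G t) ^ a ≤ E ^ a := Real.rpow_le_rpow hB0 hB ha0.le
    exact mul_le_mul h1 h2 (Real.rpow_nonneg hB0 _) (by positivity)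
  -- compare the integrands and integrate
  have hmono : ∫ t in (0 : ℝ)..T, L t ≤ ∫ t in (0 : ℝ)..T, K * (φ t * ψ t) := by
    refine intervalIntegral.integral_mono_on hT.le ?_ ?_ hpt
    · exact (hLc.mono (by rw [uIcc_of_le hT.le])).intervalIntegrable
    · exact ((continuousOn_const.mul (hφc.mul hψc)).mono (by rw [uIcc_of_le hT.le])).intervalIntegrable
  have hI1 : ∫ t in (0 : ℝ)..T, K * (φ t * ψ t) = K * ∫ s, φ s * ψ s ∂μ := by
    rw [intervalIntegral.integral_const_mul, intervalIntegral.integral_of_le hT.le, hμ]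
  calc ∫ t in (0 : ℝ)..T, L t ≤ K * ∫ s, φ s * ψ s ∂μ := hmono.trans (le_of_eq hI1)
    _ ≤ K * (Y ^ b * (T + E) ^ b₂ * E ^ a) := mul_le_mul_of_nonneg_left hH' hK0
    _ = K * Y ^ b * (T + E) ^ b₂ * E ^ a := by ring

/-- **The square `(n, m) = (1, 3)`: `∫₀ᵀ ‖∇u‖_{L⁶}^{2/3} dt` bounded a priori on `T³`** (the
endpoint `a = 1` of (A.2), i.e. plain Sobolev `‖∇u‖_{L⁶} ≤ c‖Δu‖₂`, and the Foias–Guillopé–Temam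
bound `∫₀ᵀ‖Δu‖₂^{2/3} ≤ Y₁^{1/3}(T+E)^{2/3}`): there is `K ≥ 0` (`K = C₆^{1/9}`) with
`∫₀ᵀ (∫ |∇u(t)|⁶)^{1/9} dt ≤ K · Y₁^{1/3} · (T + E)^{2/3}` along every classical mean-zero solution
on `[0, T] × T^d`, `card d = 3` (`α_{1,3} = 2/3`; `|∇u|² = ∑ⱼ‖∂ⱼu‖²`).
[cite: Gibbon2019Chessboard, Theorem 2 (i) (n = 1, m = 3), Appendix A §5.1]
[cite: FoiasGuillopeTemam1981, Thm 3.1] -/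
theorem Torus.exists_classicalNS_integral_gradL6_twoThirds_le (hd : Fintype.card d = 3) :
    ∃ K : ℝ, 0 ≤ K ∧ ∀ {ν T : ℝ}, 0 < ν → 0 < T →
      ∀ {u : ℝ → UnitAddTorus d → EuclideanSpace ℝ d} {p : ℝ → UnitAddTorus d → ℝ},
        Torus.IsClassicalNSSolutionOn (Icc 0 T) ν 0 u p →
        (∀ t ∈ Icc 0 T, Torus.HasZeroMean (u t)) →
        ∫ t in (0 : ℝ)..T,
            (∫ x, (∑ j, ‖Torus.partialDeriv j (u t) x‖ ^ 2) ^ 3) ^ ((1 : ℝ) / 9) ≤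
          K * (1 / ν + 27 * (∫ x, ‖u 0 x‖ ^ 2) / (8 * π ^ 4 * ν ^ 5)) ^ ((1 : ℝ) / 3) *
            (T + (∫ x, ‖u 0 x‖ ^ 2) / (2 * ν)) ^ ((2 : ℝ) / 3) := by
  obtain ⟨C₆, hC₆0, hC₆⟩ := Torus.exists_integral_gradSq_cube_le_laplacianSq_cube (d := d) hd
  refine ⟨C₆ ^ ((1 : ℝ) / 9), Real.rpow_nonneg hC₆0 _, ?_⟩
  intro ν T hν hT u p h hmean
  set P : ℝ → ℝ := fun s => ∫ x, ‖Torus.laplacian (u s) x‖ ^ 2 with hPdef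
  have hP0 : ∀ s, 0 ≤ P s := fun s => integral_nonneg fun x => sq_nonneg _
  set L : ℝ → ℝ := fun s =>
    (∫ x, (∑ j, ‖Torus.partialDeriv j (u s) x‖ ^ 2) ^ 3) ^ ((1 : ℝ) / 9) with hL
  have hF0 : ∀ s, 0 ≤ ∫ x, (∑ j, ‖Torus.partialDeriv j (u s) x‖ ^ 2) ^ 3 := fun s =>
    integral_nonneg fun x => pow_nonneg (Finset.sum_nonneg fun j _ => sq_nonneg _) 3
  -- pointwise: `(∫|∇u|⁶)^{1/9} ≤ C₆^{1/9} ‖Δu‖₂^{2/3}`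
  have hpt : ∀ s ∈ Icc 0 T, L s ≤ C₆ ^ ((1 : ℝ) / 9) * P s ^ ((1 : ℝ) / 3) := by
    intro s hs
    have hus : Torus.IsSmooth (u s) := h.smooth_velocity.isSmooth_slice hs
    have h1 : ∫ x, (∑ j, ‖Torus.partialDeriv j (u s) x‖ ^ 2) ^ 3 ≤ C₆ * P s ^ 3 := hC₆ (u s) hus
    have h2 := Real.rpow_le_rpow (hF0 s) h1 (by norm_num : (0 : ℝ) ≤ 1 / 9)
    refine h2.trans (le_of_eq ?_)
    rw [Real.mul_rpow hC₆0 (pow_nonneg (hP0 s) 3), show (P s ^ 3 : ℝ) = P s ^ (3 : ℝ) by norm_cast,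
      ← Real.rpow_mul (hP0 s)]
    norm_num
  -- continuity on `[0, T]`
  have hPc := (continuousOn_gradNormSq_laplacianSq' hT h).2
  have hLc : ContinuousOn L (Icc 0 T) := by
    have h3 := continuousOn_integral_gradSq_rpow hT h (by norm_num : (0 : ℝ) ≤ 3)
    have h3' : ContinuousOn (fun s => ∫ x, (∑ j, ‖Torus.partialDeriv j (u s) x‖ ^ 2) ^ 3)
        (Icc 0 T) := by
      refine h3.congr fun s _ => integral_congr_ae (ae_of_all _ fun x => ?_)
      simp only
      exact_mod_cast (Real.rpow_natCast _ 3).symm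
    exact h3'.rpow_const fun s _ => Or.inr (by norm_num)
  have hRc : ContinuousOn (fun s => C₆ ^ ((1 : ℝ) / 9) * P s ^ ((1 : ℝ) / 3)) (Icc 0 T) :=
    continuousOn_const.mul (hPc.rpow_const fun s _ => Or.inr (by norm_num))
  have hmono : ∫ t in (0 : ℝ)..T, L t ≤ ∫ t in (0 : ℝ)..T, C₆ ^ ((1 : ℝ) / 9) * P t ^ ((1 : ℝ) / 3) := by
    refine intervalIntegral.integral_mono_on hT.le ?_ ?_ hpt
    · exact (hLc.mono (by rw [uIcc_of_le hT.le])).intervalIntegrable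
    · exact (hRc.mono (by rw [uIcc_of_le hT.le])).intervalIntegrable
  rw [intervalIntegral.integral_const_mul] at hmono
  have hA : ∫ t in (0 : ℝ)..T, P t ^ ((1 : ℝ) / 3) ≤
      (1 / ν + 27 * (∫ x, ‖u 0 x‖ ^ 2) / (8 * π ^ 4 * ν ^ 5)) ^ ((1 : ℝ) / 3) *
        (T + (∫ x, ‖u 0 x‖ ^ 2) / (2 * ν)) ^ ((2 : ℝ) / 3) :=
    Torus.classicalNS_integral_laplacian_twoThirds_le hd hν hT h hmean
  calc ∫ t in (0 : ℝ)..T, L t ≤ C₆ ^ ((1 : ℝ) / 9) * ∫ t in (0 : ℝ)..T, P t ^ ((1 : ℝ) / 3) := hmono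
    _ ≤ _ := by
        rw [mul_assoc]
        exact mul_le_mul_of_nonneg_left hA (Real.rpow_nonneg hC₆0 _)

/-! ### The vorticity form (Gibbon's `D_m`) -/

/-- **Vorticity moments, `∫₀ᵀ ‖ω‖_{2m}^{2m/(4m−3)} dt` bounded a priori, `1 < m < 3`, on `T³`**
(Gibbon's `⟨D_m⟩_T`, `D_m = (ϖ₀⁻¹Ω_m)^{α_m}`, `Ω_m ∼ ‖ω‖_{2m}`, Remark 2 / eq. (2.12) with `n = 1`:
"for the case `n = 1` … an estimate for `⟨D_{1,m}⟩_T`, which was first found in [Gibbon 2011]"):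
with `K, E, Y₁` as in `Torus.exists_classicalNS_integral_gradSq_rpow_le` and
`|ω|² = torusVorticitySqAt ≤ 2|∇u|²` pointwise (`torusVorticitySqAt_le_two_mul_sum_norm_sq`),
`∫₀ᵀ (∫ |ω(t)|^{2m})^{1/(4m−3)} dt ≤ 2^{m/(4m−3)} K · Y₁^{3(m−1)/(2(4m−3))} (T + E)^{3(m−1)/(4m−3)}
E^{(3−m)/(2(4m−3))}` along every classical mean-zero solution on `[0, T] × T^d`, `card d = 3`.
[cite: Gibbon2019Chessboard, Theorem 1 / Remark 2 eq. (2.12) (n = 1, 1 < m < 3), Appendix A §5.1] -/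
theorem Torus.exists_classicalNS_integral_vorticitySq_rpow_le (hd : Fintype.card d = 3) {m : ℝ}
    (hm1 : 1 < m) (hm3 : m < 3) :
    ∃ K : ℝ, 0 ≤ K ∧ ∀ {ν T : ℝ}, 0 < ν → 0 < T →
      ∀ {u : ℝ → UnitAddTorus d → EuclideanSpace ℝ d} {p : ℝ → UnitAddTorus d → ℝ},
        Torus.IsClassicalNSSolutionOn (Icc 0 T) ν 0 u p →
        (∀ t ∈ Icc 0 T, Torus.HasZeroMean (u t)) →
        ∫ t in (0 : ℝ)..T, (∫ x, torusVorticitySqAt (u t) x ^ m) ^ (1 / (4 * m - 3)) ≤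
          K * (1 / ν + 27 * (∫ x, ‖u 0 x‖ ^ 2) / (8 * π ^ 4 * ν ^ 5)) ^
              (3 * (m - 1) / (2 * (4 * m - 3))) *
            (T + (∫ x, ‖u 0 x‖ ^ 2) / (2 * ν)) ^ (3 * (m - 1) / (4 * m - 3)) *
            ((∫ x, ‖u 0 x‖ ^ 2) / (2 * ν)) ^ ((3 - m) / (2 * (4 * m - 3))) := by
  obtain ⟨K, hK0, hK⟩ := Torus.exists_classicalNS_integral_gradSq_rpow_le (d := d) hd hm1 hm3
  have h4m : 0 < 4 * m - 3 := by linarith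
  have hm0 : (0 : ℝ) ≤ m := by linarith
  set e : ℝ := 1 / (4 * m - 3) with he
  have he0 : 0 < e := by rw [he]; positivity
  refine ⟨(2 : ℝ) ^ (m * e) * K, by positivity, ?_⟩
  intro ν T hν hT u p h hmean
  have hmain := hK hν hT h hmean
  -- pointwise in time: `(∫|ω|^{2m})^e ≤ 2^{me} (∫|∇u|^{2m})^e`
  have hpt : ∀ s ∈ Icc 0 T, (∫ x, torusVorticitySqAt (u s) x ^ m) ^ e ≤
      (2 : ℝ) ^ (m * e) * (∫ x, (∑ j, ‖Torus.partialDeriv j (u s) x‖ ^ 2) ^ m) ^ e := by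
    intro s hs
    have hus : Torus.IsSmooth (u s) := h.smooth_velocity.isSmooth_slice hs
    set F : UnitAddTorus d → ℝ := fun x => ∑ j, ‖Torus.partialDeriv j (u s) x‖ ^ 2 with hF
    have hF0 : ∀ x, 0 ≤ F x := fun x => Finset.sum_nonneg fun j _ => sq_nonneg _
    have hFc : Continuous F :=
      continuous_finsetSum _ fun j _ => (((hus.partialDeriv j).continuous).norm).pow 2
    have hω0 : ∀ x, 0 ≤ torusVorticitySqAt (u s) x := fun x => torusVorticitySqAt_nonneg _ _
    have h1 : ∫ x, torusVorticitySqAt (u s) x ^ m ≤ ∫ x, (2 * F x) ^ m :=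
      integral_mono_of_nonneg (ae_of_all _ fun x => Real.rpow_nonneg (hω0 x) _)
        (((continuous_const.mul hFc).rpow_const fun x => Or.inr hm0).integrable_unitAddTorus)
        (ae_of_all _ fun x => Real.rpow_le_rpow (hω0 x)
          (torusVorticitySqAt_le_two_mul_sum_norm_sq (u s) x) hm0)
    have h2 : ∫ x, (2 * F x) ^ m = (2 : ℝ) ^ m * ∫ x, F x ^ m := by
      have e2 : ∀ x, (2 * F x) ^ m = (2 : ℝ) ^ m * F x ^ m := fun x =>
        Real.mul_rpow zero_le_two (hF0 x)
      simp_rw [e2]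
      exact integral_const_mul _ _
    have hI0 : 0 ≤ ∫ x, torusVorticitySqAt (u s) x ^ m :=
      integral_nonneg fun x => Real.rpow_nonneg (hω0 x) _
    have hJ0 : 0 ≤ ∫ x, F x ^ m := integral_nonneg fun x => Real.rpow_nonneg (hF0 x) _
    calc (∫ x, torusVorticitySqAt (u s) x ^ m) ^ e ≤ ((2 : ℝ) ^ m * ∫ x, F x ^ m) ^ e :=
          Real.rpow_le_rpow hI0 (h1.trans_eq h2) he0.le
      _ = ((2 : ℝ) ^ m) ^ e * (∫ x, F x ^ m) ^ e := Real.mul_rpow (by positivity) hJ0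
      _ = (2 : ℝ) ^ (m * e) * (∫ x, F x ^ m) ^ e := by rw [← Real.rpow_mul zero_le_two]
  -- integrate over `[0, T]`
  have hLc : ContinuousOn
      (fun s => (∫ x, (∑ j, ‖Torus.partialDeriv j (u s) x‖ ^ 2) ^ m) ^ e) (Icc 0 T) :=
    (continuousOn_integral_gradSq_rpow hT h hm0).rpow_const fun s _ => Or.inr he0.le
  have hΩc : ContinuousOn (fun s => (∫ x, torusVorticitySqAt (u s) x ^ m) ^ e) (Icc 0 T) :=
    (continuousOn_integral_vorticitySq_rpow hT h hm0).rpow_const fun s _ => Or.inr he0.le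
  have hmono : ∫ t in (0 : ℝ)..T, (∫ x, torusVorticitySqAt (u t) x ^ m) ^ e ≤
      ∫ t in (0 : ℝ)..T,
        (2 : ℝ) ^ (m * e) * (∫ x, (∑ j, ‖Torus.partialDeriv j (u t) x‖ ^ 2) ^ m) ^ e := by
    refine intervalIntegral.integral_mono_on hT.le ?_ ?_ hpt
    · exact (hΩc.mono (by rw [uIcc_of_le hT.le])).intervalIntegrable
    · exact ((continuousOn_const.mul hLc).mono (by rw [uIcc_of_le hT.le])).intervalIntegrable
  rw [intervalIntegral.integral_const_mul] at hmono
  refine hmono.trans ?_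
  refine (mul_le_mul_of_nonneg_left hmain (by positivity)).trans (le_of_eq ?_)
  ring

/-! ### Row `n = 0`, `3 < m < ∞`: the inputs (`L⁶` Sobolev for mean-zero fields, sup × `L⁶`) -/

/-- **The mean-zero Sobolev embedding `‖v‖_{L⁶} ≤ c‖∇v‖_{L²}` on `T³`, Bochner form.** On `T^d`,
`card d = 3`, there is `C ≥ 0` such that `∫‖v‖⁶ ≤ C (∫|∇v|²)³` for every smooth mean-zero `v`
(the tree's `H¹ ⊂ L⁶` embedding `Torus.lintegral_enorm_pow_six_le_cube_of_isSmooth`, the Poincaré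
inequality `Torus.integral_norm_sq_le_of_hasZeroMean` and `∫‖Dv‖² ≤ d ∫∑ₖ‖∂ₖv‖²`).
[cite: RobinsonRodrigoSadowskiCUP2016, Thm 1.18 (H¹ ⊂ L⁶ on T³, mean-zero form used in Lemma 8.16)] -/
theorem Torus.exists_integral_norm_pow_six_le_gradNormSq_cube (hd : Fintype.card d = 3) :
    ∃ C : ℝ, 0 ≤ C ∧ ∀ v : UnitAddTorus d → EuclideanSpace ℝ d, Torus.IsSmooth v →
      Torus.HasZeroMean v → ∫ x, ‖v x‖ ^ 6 ≤ C * Torus.gradNormSq v ^ 3 := by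
  obtain ⟨K, hK⟩ := Torus.lintegral_enorm_pow_six_le_cube_of_isSmooth (F' := EuclideanSpace ℝ d) hd
  have hK0 : (0 : ℝ) ≤ K := NNReal.coe_nonneg K
  refine ⟨(K : ℝ) * (((Fintype.card d : ℝ) ^ 2 + 1) * Fintype.card d) ^ 3, by positivity,
    fun w hws hw0 => ?_⟩
  have hwc : Continuous w := hws.continuous
  have hDc : Continuous (Torus.fderiv w) := Torus.continuous_fderiv_of_isSmooth hws
  have hG0 : 0 ≤ Torus.gradNormSq w := Torus.gradNormSq_nonneg _
  -- Bochner form of the `L⁶` embedding for `w`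
  have h6 := hK w hws
  have conv : ∀ {g : UnitAddTorus d → ℝ} (_ : Continuous g) (_ : ∀ x, 0 ≤ g x) (k : ℕ),
      ∫⁻ x, (ENNReal.ofReal (g x)) ^ k = ENNReal.ofReal (∫ x, g x ^ k) := by
    intro g hg hg0 k
    have hi : Integrable (fun x => g x ^ k) volume := (hg.pow k).integrable_unitAddTorus
    rw [ofReal_integral_eq_lintegral_ofReal hi (ae_of_all _ fun x => pow_nonneg (hg0 x) k)]
    exact lintegral_congr fun x => (ENNReal.ofReal_pow (hg0 x) k).symm
  have e6 : ∫⁻ x, ‖w x‖ₑ ^ 6 = ENNReal.ofReal (∫ x, ‖w x‖ ^ 6) := by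
    rw [← conv hwc.norm (fun x => norm_nonneg _) 6]
    exact lintegral_congr fun x => by rw [ofReal_norm]
  have e2 : ∫⁻ x, ‖w x‖ₑ ^ 2 = ENNReal.ofReal (∫ x, ‖w x‖ ^ 2) := by
    rw [← conv hwc.norm (fun x => norm_nonneg _) 2]
    exact lintegral_congr fun x => by rw [ofReal_norm]
  have eD : ∫⁻ x, ‖Torus.fderiv w x‖ₑ ^ 2 = ENNReal.ofReal (∫ x, ‖Torus.fderiv w x‖ ^ 2) := by
    rw [← conv hDc.norm (fun x => norm_nonneg _) 2]
    exact lintegral_congr fun x => by rw [ofReal_norm]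
  have hA0 : 0 ≤ ∫ x, ‖w x‖ ^ 2 := integral_nonneg fun x => sq_nonneg _
  have hB0 : 0 ≤ ∫ x, ‖Torus.fderiv w x‖ ^ 2 := integral_nonneg fun x => sq_nonneg _
  rw [e6, e2, eD, ← ENNReal.ofReal_add hA0 hB0, ← ENNReal.ofReal_pow (by positivity),
    ← ENNReal.ofReal_coe_nnreal, ← ENNReal.ofReal_mul hK0] at h6
  have h6' : ∫ x, ‖w x‖ ^ 6 ≤ K * ((∫ x, ‖w x‖ ^ 2) + ∫ x, ‖Torus.fderiv w x‖ ^ 2) ^ 3 :=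
    (ENNReal.ofReal_le_ofReal_iff (by positivity)).1 h6
  -- Poincaré and `∫‖Dw‖² ≤ d ∫∑ₖ‖∂ₖw‖²`
  have hPoinc : ∫ x, ‖w x‖ ^ 2 ≤ (Fintype.card d : ℝ) ^ 2 * ∫ x, ‖Torus.fderiv w x‖ ^ 2 :=
    Torus.integral_norm_sq_le_of_hasZeroMean hws hw0
  have hDw : ∫ x, ‖Torus.fderiv w x‖ ^ 2 ≤ Fintype.card d * Torus.gradNormSq w :=
    Torus.integral_norm_fderiv_sq_le_card_mul_gradNormSq hws
  have hsum2 : (∫ x, ‖w x‖ ^ 2) + ∫ x, ‖Torus.fderiv w x‖ ^ 2 ≤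
      ((Fintype.card d : ℝ) ^ 2 + 1) * Fintype.card d * Torus.gradNormSq w := by
    have hd1 : (0 : ℝ) ≤ (Fintype.card d : ℝ) ^ 2 + 1 := by positivity
    calc (∫ x, ‖w x‖ ^ 2) + ∫ x, ‖Torus.fderiv w x‖ ^ 2
        ≤ (Fintype.card d : ℝ) ^ 2 * (∫ x, ‖Torus.fderiv w x‖ ^ 2) +
            ∫ x, ‖Torus.fderiv w x‖ ^ 2 := by linarith [hPoinc]
      _ = ((Fintype.card d : ℝ) ^ 2 + 1) * ∫ x, ‖Torus.fderiv w x‖ ^ 2 := by ring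
      _ ≤ ((Fintype.card d : ℝ) ^ 2 + 1) * (Fintype.card d * Torus.gradNormSq w) :=
          mul_le_mul_of_nonneg_left hDw hd1
      _ = ((Fintype.card d : ℝ) ^ 2 + 1) * Fintype.card d * Torus.gradNormSq w := by ring
  calc ∫ x, ‖w x‖ ^ 6 ≤ K * ((∫ x, ‖w x‖ ^ 2) + ∫ x, ‖Torus.fderiv w x‖ ^ 2) ^ 3 := h6'
    _ ≤ K * (((Fintype.card d : ℝ) ^ 2 + 1) * Fintype.card d * Torus.gradNormSq w) ^ 3 := by
        gcongr
    _ = K * (((Fintype.card d : ℝ) ^ 2 + 1) * Fintype.card d) ^ 3 * Torus.gradNormSq w ^ 3 := by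
        ring

/-- **Gibbon (A.8) with `N = 2`, `3 < m`, integrated** (`‖v‖_{L^{2m}} ≤ c‖∇²v‖₂^B‖∇v‖₂^{1−B}`,
`B = (m−3)/(2m)`), on `T^d`, `card d = 3`: for a smooth mean-zero `v` with the Sobolev bound
`∫‖v‖⁶ ≤ C (∫|∇v|²)³`, `∫ ‖v‖^{2m} ≤ C (4/π⁴)^{(m−3)/2} (∫|∇v|²)^{(m+3)/2} (∫‖Δv‖²)^{(m−3)/2}`
(sup × `L⁶`: `‖v‖^{2m} ≤ A^{2m−6}‖v‖⁶` with the explicit Agmon majorant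
`A = (4/π⁴ ‖∇v‖₂² ‖Δv‖₂²)^{1/4}`, `Torus.norm_le_agmonMajorant`).
[cite: Gibbon2019Chessboard, Appendix A §5.2 eq. (A.8) (N = 2)] -/
theorem Torus.integral_norm_rpow_le_of_six_le (hd : Fintype.card d = 3) {m : ℝ} (hm : 3 < m)
    {v : UnitAddTorus d → EuclideanSpace ℝ d} (hv : Torus.IsSmooth v) (hmean : Torus.HasZeroMean v)
    {C : ℝ} (hC : ∫ x, ‖v x‖ ^ 6 ≤ C * Torus.gradNormSq v ^ 3) :
    ∫ x, ‖v x‖ ^ (2 * m) ≤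
      C * (4 / π ^ 4) ^ ((m - 3) / 2) * Torus.gradNormSq v ^ ((m + 3) / 2) *
        (∫ y, ‖Torus.laplacian v y‖ ^ 2) ^ ((m - 3) / 2) := by
  have hπ : 0 < π := Real.pi_pos
  set G : ℝ := Torus.gradNormSq v with hGdef
  set P : ℝ := ∫ y, ‖Torus.laplacian v y‖ ^ 2 with hPdef
  have hG0 : 0 ≤ G := Torus.gradNormSq_nonneg _
  have hP0 : 0 ≤ P := integral_nonneg fun x => sq_nonneg _
  have hc0 : (0 : ℝ) ≤ 4 / π ^ 4 := by positivity
  set A : ℝ := (4 / π ^ 4 * G * P) ^ ((1 : ℝ) / 4) with hA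
  have hA0 : 0 ≤ A := Real.rpow_nonneg (by positivity) _
  have hvA : ∀ x, ‖v x‖ ≤ A := Torus.norm_le_agmonMajorant hd hv hmean
  -- pointwise `‖v‖^{2m} ≤ A^{2m-6} ‖v‖⁶`
  have hpt : ∀ x, ‖v x‖ ^ (2 * m) ≤ A ^ (2 * m - 6) * ‖v x‖ ^ 6 := by
    intro x
    have h0 : 0 ≤ ‖v x‖ := norm_nonneg _
    have hne : 2 * m - 6 + 6 ≠ 0 := ne_of_gt (by linarith)
    have e : ‖v x‖ ^ (2 * m) = ‖v x‖ ^ (2 * m - 6) * ‖v x‖ ^ 6 := by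
      rw [show (‖v x‖ ^ 6 : ℝ) = ‖v x‖ ^ (6 : ℝ) by norm_cast, ← Real.rpow_add' h0 hne]
      congr 1
      ring
    rw [e]
    exact mul_le_mul_of_nonneg_right (Real.rpow_le_rpow h0 (hvA x) (by linarith))
      (pow_nonneg h0 6)
  have hvc : Continuous v := hv.continuous
  have hint6 : Integrable (fun x => ‖v x‖ ^ 6) volume := (hvc.norm.pow 6).integrable_unitAddTorus
  have h1 : ∫ x, ‖v x‖ ^ (2 * m) ≤ ∫ x, A ^ (2 * m - 6) * ‖v x‖ ^ 6 :=
    integral_mono_of_nonneg (ae_of_all _ fun x => Real.rpow_nonneg (norm_nonneg _) _)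
      (hint6.const_mul _) (ae_of_all _ hpt)
  rw [MeasureTheory.integral_const_mul] at h1
  have h2 : A ^ (2 * m - 6) = (4 / π ^ 4) ^ ((m - 3) / 2) * G ^ ((m - 3) / 2) * P ^ ((m - 3) / 2) := by
    rw [hA, ← Real.rpow_mul (by positivity), show (1 : ℝ) / 4 * (2 * m - 6) = (m - 3) / 2 by ring,
      Real.mul_rpow (by positivity) hP0, Real.mul_rpow hc0 hG0]
  have hI6 : 0 ≤ ∫ x, ‖v x‖ ^ 6 := integral_nonneg fun x => pow_nonneg (norm_nonneg _) 6
  have hC' : 0 ≤ C * G ^ 3 := hI6.trans hC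
  have hG3 : G ^ ((m + 3) / 2) = G ^ ((m - 3) / 2) * G ^ 3 := by
    rw [show (G ^ 3 : ℝ) = G ^ (3 : ℝ) by norm_cast,
      ← Real.rpow_add' hG0 (ne_of_gt (by linarith : (0 : ℝ) < (m - 3) / 2 + 3))]
    congr 1
    ring
  calc ∫ x, ‖v x‖ ^ (2 * m) ≤ A ^ (2 * m - 6) * ∫ x, ‖v x‖ ^ 6 := h1
    _ ≤ A ^ (2 * m - 6) * (C * G ^ 3) := mul_le_mul_of_nonneg_left hC (Real.rpow_nonneg hA0 _)
    _ = C * (4 / π ^ 4) ^ ((m - 3) / 2) * G ^ ((m + 3) / 2) * P ^ ((m - 3) / 2) := by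
        rw [h2, hG3]; ring

/-- Along a classical solution on `[a, b]`, `t ↦ ∫ ‖u(t)‖^r` is continuous on `[a, b]` for
`0 ≤ r` (joint smoothness, tube lemma). [folklore] -/
private theorem continuousOn_integral_norm_rpow {ν : ℝ} {S : Set ℝ}
    {f u : ℝ → UnitAddTorus d → EuclideanSpace ℝ d} {p : ℝ → UnitAddTorus d → ℝ}
    (h : Torus.IsClassicalNSSolutionOn S ν f u p) {r : ℝ} (hr : 0 ≤ r) :
    ContinuousOn (fun t => ∫ x, ‖u t x‖ ^ r) S := by
  have hst : ContinuousOn (Torus.stLift u) (S ×ˢ univ) := h.smooth_velocity.continuousOn_stLift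
  refine continuousOn_integral_of_continuousOn_stLift ?_ fun t ht => ?_
  · have e : Torus.stLift (fun t x => ‖u t x‖ ^ r) = fun q => ‖Torus.stLift u q‖ ^ r := rfl
    rw [e]
    exact hst.norm.rpow_const fun q _ => Or.inr hr
  · exact ((h.smooth_velocity.isSmooth_slice ht).continuous.norm).rpow_const fun x => Or.inr hr

/-! ### Theorem 2 (ii), row `n = 0`, `3 < m < ∞` -/

/-- **Gibbon's chessboard, row `n = 0`, `3 < m < ∞`, on `T³`** (classical solutions, written out
in `ν, T, ‖u(0)‖₂`). On `T^d`, `card d = 3`, for `3 < m` there is `K ≥ 0` (namely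
`K = (C (4/π⁴)^{(m−3)/2})^{1/(2m−3)}`, `C` the mean-zero Sobolev constant of
`Torus.exists_integral_norm_pow_six_le_gradNormSq_cube`) such that every classical solution of the
unforced Navier–Stokes equations with `ν > 0` on `[0, T] × T^d`, `T > 0`, with mean-zero velocity
slices satisfies, with `E = ‖u(0)‖₂²/(2ν)`, `Y₁ = 1/ν + 27‖u(0)‖₂²/(8π⁴ν⁵)`,
`∫₀ᵀ (∫ ‖u(t)‖^{2m})^{1/(2m−3)} dt ≤ K · Y₁^{(m−3)/(2(2m−3))} · (T + E)^{(m−3)/(2m−3)} ·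
E^{(m+3)/(2(2m−3))}` — i.e. `⟨‖u‖_{2m}^{α_{0,m}}⟩_T`, `α_{0,m} = 2m/(2m−3)`, is bounded a priori
(printed for Leray–Hopf weak solutions of the forced equations, `≤ c Re³ + O(T⁻¹)`, `n = 0`,
`3 < m ≤ ∞`). Proof as printed (Appendix A §5.2 with `N = 2`): (A.8), then Hölder in time with
exponents `2(2m−3)/(3(m−3))`, `2(2m−3)/(m+3)` ((A.9)–(A.10)) against the Foias–Guillopé–Temam
bounds `∫₀ᵀ‖Δu‖₂^{2/3} ≤ Y₁^{1/3}(T+E)^{2/3}` and `∫₀ᵀ‖∇u‖₂² ≤ E`. (`m = ∞` is the bounded total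
speed `Torus.classicalNS_integral_agmonMajorant_le`; `m → 3⁺` is the Sobolev bound `∫₀ᵀ‖u‖₆² ≤ CE`.)
[cite: Gibbon2019Chessboard, Theorem 2 (ii) (n = 0, 3 < m < ∞), Appendix A §5.2]
[cite: FoiasGuillopeTemam1981, Thm 3.1] -/
theorem Torus.exists_classicalNS_integral_norm_rpow_le (hd : Fintype.card d = 3) {m : ℝ}
    (hm : 3 < m) :
    ∃ K : ℝ, 0 ≤ K ∧ ∀ {ν T : ℝ}, 0 < ν → 0 < T →
      ∀ {u : ℝ → UnitAddTorus d → EuclideanSpace ℝ d} {p : ℝ → UnitAddTorus d → ℝ},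
        Torus.IsClassicalNSSolutionOn (Icc 0 T) ν 0 u p →
        (∀ t ∈ Icc 0 T, Torus.HasZeroMean (u t)) →
        ∫ t in (0 : ℝ)..T, (∫ x, ‖u t x‖ ^ (2 * m)) ^ (1 / (2 * m - 3)) ≤
          K * (1 / ν + 27 * (∫ x, ‖u 0 x‖ ^ 2) / (8 * π ^ 4 * ν ^ 5)) ^
              ((m - 3) / (2 * (2 * m - 3))) *
            (T + (∫ x, ‖u 0 x‖ ^ 2) / (2 * ν)) ^ ((m - 3) / (2 * m - 3)) *
            ((∫ x, ‖u 0 x‖ ^ 2) / (2 * ν)) ^ ((m + 3) / (2 * (2 * m - 3))) := by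
  obtain ⟨C, hC0, hC⟩ := Torus.exists_integral_norm_pow_six_le_gradNormSq_cube (d := d) hd
  have hπ : 0 < π := Real.pi_pos
  have h2m : 0 < 2 * m - 3 := by linarith
  have hm3 : 0 < m - 3 := by linarith
  have hm3' : 0 < m + 3 := by linarith
  -- exponents
  set e : ℝ := 1 / (2 * m - 3) with he
  set b : ℝ := (m - 3) / (2 * (2 * m - 3)) with hb
  set b₂ : ℝ := (m - 3) / (2 * m - 3) with hb₂
  set a : ℝ := (m + 3) / (2 * (2 * m - 3)) with ha
  have he0 : 0 < e := by rw [he]; positivity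
  have hb0 : 0 < b := by rw [hb]; positivity
  have ha0 : 0 < a := by rw [ha]; positivity
  have hc0 : (0 : ℝ) ≤ C * (4 / π ^ 4) ^ ((m - 3) / 2) := by positivity
  set K : ℝ := (C * (4 / π ^ 4) ^ ((m - 3) / 2)) ^ e with hK
  have hK0 : 0 ≤ K := Real.rpow_nonneg hc0 _
  refine ⟨K, hK0, ?_⟩
  intro ν T hν hT u p h hmean
  have hu0 : 0 ≤ ∫ x, ‖u 0 x‖ ^ 2 := integral_nonneg fun x => sq_nonneg _
  set E : ℝ := (∫ x, ‖u 0 x‖ ^ 2) / (2 * ν) with hE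
  set Y : ℝ := 1 / ν + 27 * (∫ x, ‖u 0 x‖ ^ 2) / (8 * π ^ 4 * ν ^ 5) with hY
  have hE0 : 0 ≤ E := by positivity
  have hY0 : 0 ≤ Y := by positivity
  have hTE : 0 ≤ T + E := by positivity
  set G : ℝ → ℝ := fun s => Torus.gradNormSq (u s) with hGdef
  set P : ℝ → ℝ := fun s => ∫ x, ‖Torus.laplacian (u s) x‖ ^ 2 with hPdef
  have hG0 : ∀ s, 0 ≤ G s := fun s => Torus.gradNormSq_nonneg _
  have hP0 : ∀ s, 0 ≤ P s := fun s => integral_nonneg fun x => sq_nonneg _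
  -- Hölder factors `φ = ‖Δu‖₂^{2b}`, `ψ = ‖∇u‖₂^{2a}`
  set φ : ℝ → ℝ := fun s => P s ^ b with hφ
  set ψ : ℝ → ℝ := fun s => G s ^ a with hψ
  have hφ0 : ∀ s, 0 ≤ φ s := fun s => Real.rpow_nonneg (hP0 s) _
  have hψ0 : ∀ s, 0 ≤ ψ s := fun s => Real.rpow_nonneg (hG0 s) _
  -- the integrand and its pointwise bound (A.8): `(∫‖u‖^{2m})^e ≤ K φ ψ` on `[0, T]`
  set L : ℝ → ℝ := fun s => (∫ x, ‖u s x‖ ^ (2 * m)) ^ e with hL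
  have hF0 : ∀ s, 0 ≤ ∫ x, ‖u s x‖ ^ (2 * m) := fun s =>
    integral_nonneg fun x => Real.rpow_nonneg (norm_nonneg _) _
  have hpt : ∀ s ∈ Icc 0 T, L s ≤ K * (φ s * ψ s) := by
    intro s hs
    have hus : Torus.IsSmooth (u s) := h.smooth_velocity.isSmooth_slice hs
    have h1 : ∫ x, ‖u s x‖ ^ (2 * m) ≤
        C * (4 / π ^ 4) ^ ((m - 3) / 2) * G s ^ ((m + 3) / 2) * P s ^ ((m - 3) / 2) :=
      Torus.integral_norm_rpow_le_of_six_le hd hm hus (hmean s hs) (hC (u s) hus (hmean s hs))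
    have h2 := Real.rpow_le_rpow (hF0 s) h1 he0.le
    refine h2.trans (le_of_eq ?_)
    rw [Real.mul_rpow (mul_nonneg hc0 (Real.rpow_nonneg (hG0 s) _)) (Real.rpow_nonneg (hP0 s) _),
      Real.mul_rpow hc0 (Real.rpow_nonneg (hG0 s) _), ← Real.rpow_mul (hG0 s),
      ← Real.rpow_mul (hP0 s)]
    have xa : (m + 3) / 2 * e = a := by rw [ha, he]; field_simp
    have xb : (m - 3) / 2 * e = b := by rw [hb, he]; field_simp
    rw [xa, xb, ← hK]
    simp only [hφ, hψ]
    ring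
  -- continuity on `[0, T]`
  obtain ⟨hGc, hPc⟩ := continuousOn_gradNormSq_laplacianSq' hT h
  have hφc : ContinuousOn φ (Icc 0 T) := hPc.rpow_const fun s _ => Or.inr hb0.le
  have hψc : ContinuousOn ψ (Icc 0 T) := hGc.rpow_const fun s _ => Or.inr ha0.le
  have hLc : ContinuousOn L (Icc 0 T) :=
    (continuousOn_integral_norm_rpow h (by linarith : (0 : ℝ) ≤ 2 * m)).rpow_const
      fun s _ => Or.inr he0.le
  -- Hölder in time, exponents `p₁ = 2(2m−3)/(3(m−3))`, `q₁ = 2(2m−3)/(m+3)` ((A.9)–(A.10))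
  have hm3ne : m - 3 ≠ 0 := hm3.ne'
  have h2mne : 2 * m - 3 ≠ 0 := h2m.ne'
  have hm3ne' : m + 3 ≠ 0 := hm3'.ne'
  set p₁ : ℝ := 2 * (2 * m - 3) / (3 * (m - 3)) with hp₁
  set q₁ : ℝ := 2 * (2 * m - 3) / (m + 3) with hq₁
  have hpq : p₁.HolderConjugate q₁ := by
    refine Real.holderConjugate_iff.2 ⟨?_, ?_⟩
    · rw [hp₁, lt_div_iff₀ (by positivity)]; linarith
    · rw [hp₁, hq₁]; field_simp; ring
  set μ : Measure ℝ := volume.restrict (Ioc 0 T) with hμ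
  haveI : IsFiniteMeasure μ := by rw [hμ]; infer_instance
  have hmemLp : ∀ {g : ℝ → ℝ}, ContinuousOn g (Icc 0 T) → ∀ r : ℝ≥0∞, MemLp g r μ := by
    intro g hg r
    obtain ⟨C', hC'⟩ := isCompact_Icc.exists_bound_of_continuousOn hg
    have hmeas : AEStronglyMeasurable g μ :=
      (hg.mono Ioc_subset_Icc_self).aestronglyMeasurable measurableSet_Ioc
    refine MemLp.of_bound hmeas C' ?_
    rw [hμ, ae_restrict_iff' measurableSet_Ioc]
    exact ae_of_all _ fun s hs => hC' s (Ioc_subset_Icc_self hs)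
  have hH := integral_mul_le_Lp_mul_Lq_of_nonneg (μ := μ) hpq
    (ae_of_all _ fun s => hφ0 s) (ae_of_all _ fun s => hψ0 s) (hmemLp hφc _) (hmemLp hψc _)
  have hφp : ∀ s, φ s ^ p₁ = P s ^ ((1 : ℝ) / 3) := fun s => by
    rw [hφ]
    simp only
    rw [← Real.rpow_mul (hP0 s)]
    congr 1
    rw [hb, hp₁, div_mul_div_comm, div_eq_div_iff (by positivity) (by norm_num)]
    ring
  have hψq : ∀ s, ψ s ^ q₁ = G s := fun s => by
    rw [hψ]
    simp only
    rw [← Real.rpow_mul (hG0 s)]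
    have : a * q₁ = 1 := by
      rw [ha, hq₁, div_mul_div_comm, div_eq_one_iff_eq (by positivity)]
      ring
    rw [this, Real.rpow_one]
  have hI2 : ∫ s, φ s ^ p₁ ∂μ = ∫ t in (0 : ℝ)..T, P t ^ ((1 : ℝ) / 3) := by
    rw [intervalIntegral.integral_of_le hT.le, hμ]
    exact integral_congr_ae (ae_of_all _ fun s => hφp s)
  have hI3 : ∫ s, ψ s ^ q₁ ∂μ = ∫ t in (0 : ℝ)..T, G t := by
    rw [intervalIntegral.integral_of_le hT.le, hμ]
    exact integral_congr_ae (ae_of_all _ fun s => hψq s)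
  rw [hI2, hI3] at hH
  -- the Foias–Guillopé–Temam inputs
  have hA : ∫ t in (0 : ℝ)..T, P t ^ ((1 : ℝ) / 3) ≤ Y ^ ((1 : ℝ) / 3) * (T + E) ^ ((2 : ℝ) / 3) :=
    Torus.classicalNS_integral_laplacian_twoThirds_le hd hν hT h hmean
  have hB : ∫ t in (0 : ℝ)..T, G t ≤ E := Torus.classicalNS_integral_gradNormSq_le hν hT h
  have hA0 : 0 ≤ ∫ t in (0 : ℝ)..T, P t ^ ((1 : ℝ) / 3) :=
    intervalIntegral.integral_nonneg hT.le fun s _ => Real.rpow_nonneg (hP0 s) _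
  have hB0 : 0 ≤ ∫ t in (0 : ℝ)..T, G t := intervalIntegral.integral_nonneg hT.le fun s _ => hG0 s
  have x1p : 1 / p₁ = 3 * (m - 3) / (2 * (2 * m - 3)) := by rw [hp₁, one_div_div]
  have x1q : 1 / q₁ = a := by rw [hq₁, ha, one_div_div]
  have hH' : ∫ s, φ s * ψ s ∂μ ≤ Y ^ b * (T + E) ^ b₂ * E ^ a := by
    refine hH.trans ?_
    rw [x1p, x1q]
    have h1 : (∫ t in (0 : ℝ)..T, P t ^ ((1 : ℝ) / 3)) ^ (3 * (m - 3) / (2 * (2 * m - 3))) ≤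
        Y ^ b * (T + E) ^ b₂ := by
      have h := Real.rpow_le_rpow hA0 hA
        (by positivity : (0 : ℝ) ≤ 3 * (m - 3) / (2 * (2 * m - 3)))
      refine h.trans (le_of_eq ?_)
      rw [Real.mul_rpow (Real.rpow_nonneg hY0 _) (Real.rpow_nonneg hTE _), ← Real.rpow_mul hY0,
        ← Real.rpow_mul hTE]
      have y1 : (1 : ℝ) / 3 * (3 * (m - 3) / (2 * (2 * m - 3))) = b := by
        rw [hb]; field_simp
      have y2 : (2 : ℝ) / 3 * (3 * (m - 3) / (2 * (2 * m - 3))) = b₂ := by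
        rw [hb₂]; field_simp
      rw [y1, y2]
    have h2 : (∫ t in (0 : ℝ)..T, G t) ^ a ≤ E ^ a := Real.rpow_le_rpow hB0 hB ha0.le
    exact mul_le_mul h1 h2 (Real.rpow_nonneg hB0 _) (by positivity)
  -- compare the integrands and integrate
  have hmono : ∫ t in (0 : ℝ)..T, L t ≤ ∫ t in (0 : ℝ)..T, K * (φ t * ψ t) := by
    refine intervalIntegral.integral_mono_on hT.le ?_ ?_ hpt
    · exact (hLc.mono (by rw [uIcc_of_le hT.le])).intervalIntegrable
    · exact ((continuousOn_const.mul (hφc.mul hψc)).mono (by rw [uIcc_of_le hT.le])).intervalIntegrable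
  have hI1 : ∫ t in (0 : ℝ)..T, K * (φ t * ψ t) = K * ∫ s, φ s * ψ s ∂μ := by
    rw [intervalIntegral.integral_const_mul, intervalIntegral.integral_of_le hT.le, hμ]
  calc ∫ t in (0 : ℝ)..T, L t ≤ K * ∫ s, φ s * ψ s ∂μ := hmono.trans (le_of_eq hI1)
    _ ≤ K * (Y ^ b * (T + E) ^ b₂ * E ^ a) := mul_le_mul_of_nonneg_left hH' hK0
    _ = K * Y ^ b * (T + E) ^ b₂ * E ^ a := by ring

end Literature.Analysis.FluidPDE

end
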